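import Summits.BirchSwinnertonDyer.Rank1Residual.Additive.CensusX43ValueModule
import HarnessLib

/-!
# Non-vacuity of the X4-3 typed relation: the Teichmüller power `ω^t` EXISTS as a `ℚ_p`-valued
# multiplicative character of `ℤ/p` (cell `b2b-bsdres`, census cell, seat `b2b-bsdres-census-ctyper1`,
# gen 2; companion of `Additive/CensusX43ValueModule.lean`)

HONEST FRAMING (cell `b2b-bsdres`, run/shared/lean/b2b/bsd-rank1-residual/, verbatim in every
file): the goal of the cell is to DELETE the COMBINATION-SHAPED residual classes of the
Birch–Swinnerton-Dyer formula for ALL analytic-rank `≤ 1` elliptic curves over `ℚ` — "full BSD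
formula for every rank `≤ 1` curve in class `C`" assembled STRICTLY from published theorems — so
that the rank-`≤ 1` remainder becomes exactly the CONSTRUCTION-SHAPED classes, which are TYPED
(missing-input `Prop`s), NOT attempted. This is not "finishing BSD". Census cell: research
instrumentation; nothing booked; labels UNCHANGED. Theorems only; no definition, no named fact.

`CensusX43.RelationAt W p` quantifies over every `χ : MulChar (ZMod p) ℚ_[p]` with
`IsTeichmullerPow χ t` (`χ(a) ≡ a^t (mod p)`). This file proves that for odd `p` such a `χ` EXISTS
for every `t` (`exists_isTeichmullerPow`), so the `∀ χ` clause is never vacuous: `χ = ω^t` with `ω`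
the Teichmüller character, built from the tree's Teichmüller representative map `teichRep`
(`PAdicLFunctionBranchConstantTermProofs.lean`: the inverse of the reduction bijection
`μ_{p−1}(ℤ_p) → (ℤ/p)ˣ`, Washington §5.1), shown multiplicative here (`teichRep_mul`), pushed to
`ℚ_pˣ`, raised to the `t`-th power and packaged by Mathlib's `MulChar.ofUnitHom`; the congruence
`ω(a)^t ≡ a^t (mod p)` is `ω(a) ≡ a` and `(x − y) ∣ (x^t − y^t)` in `ℤ_p`. (Uniqueness — two such `χ`
agree, since congruent `(p−1)`-th roots of unity in `ℤ_p` are equal — is not needed by any consumer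
and not proved here.) Reference: L. Washington, *Introduction to Cyclotomic Fields*, §5.1;
Mazur–Tate–Teitelbaum 1986 §I.13 [MazurTateTeitelbaum1986Invent].
-/

noncomputable section

open scoped Classical

open Literature.NumberTheory.EllipticCurves

namespace Summit.BirchSwinnertonDyer.Rank1Residual.Additive

namespace CensusX43

variable (p : ℕ) [hp : Fact p.Prime]

/-- `teichReduce` is multiplicative (it is reduction of units). [cite: MazurTateTeitelbaum1986Invent, §I.13] -/
theorem teichReduce_mul (η η' : rootsOfUnity (torsionOrder p) ℤ_[p]) :
    teichReduce p (η * η') = teichReduce p η * teichReduce p η' := by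
  ext
  simp only [val_teichReduce, Units.val_mul, Subgroup.coe_mul, map_mul]

/-- **The Teichmüller representative map is multiplicative**: `ω(ab) = ω(a)ω(b)` (inverse of a
multiplicative bijection). [cite: MazurTateTeitelbaum1986Invent, §I.13] -/
theorem teichRep_mul (a b : (ZMod (p ^ cyclotomicExponent p))ˣ) :
    teichRep p (a * b) = teichRep p a * teichRep p b := by
  apply (teichReduce_bijective p).1
  rw [teichReduce_teichRep, teichReduce_mul, teichReduce_teichRep, teichReduce_teichRep]

/-- `ω(1) = 1`. [cite: MazurTateTeitelbaum1986Invent, §I.13] -/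
theorem teichRep_one : teichRep p 1 = 1 := by
  apply (teichReduce_bijective p).1
  rw [teichReduce_teichRep]
  ext
  simp only [val_teichReduce, Units.val_one, OneMemClass.coe_one, map_one]

/-- `ω(a) ≡ a (mod p^{e₀})` in `ℤ_p`: the Teichmüller representative reduces to its class, so
`ω(a) − n` is divisible by `p^{e₀}` for any natural number `n` in the class `a`.
[cite: MazurTateTeitelbaum1986Invent, §I.13] -/
theorem pow_dvd_teichRep_sub_natCast (a : (ZMod (p ^ cyclotomicExponent p))ˣ) (n : ℕ)
    (hn : (n : ZMod (p ^ cyclotomicExponent p)) = (a : ZMod (p ^ cyclotomicExponent p))) :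
    (p : ℤ_[p]) ^ cyclotomicExponent p ∣
      (((teichRep p a : rootsOfUnity (torsionOrder p) ℤ_[p]) : ℤ_[p]ˣ) : ℤ_[p]) - n := by
  rw [← Ideal.mem_span_singleton, ← PadicInt.ker_toZModPow, RingHom.mem_ker, map_sub,
    map_natCast, ← val_teichReduce, teichReduce_teichRep, hn, sub_self]

/-- **Non-vacuity of the `∀ χ` clause of `CensusX43.RelationAt`**: for odd `p` and every `t` there
is a multiplicative character `χ : (ℤ/p) → ℚ_p` with `χ(a) ≡ a^t (mod p)` for all units `a` —
namely `ω^t`, `ω` the Teichmüller character. [cite: MazurTateTeitelbaum1986Invent, §I.13] -/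
theorem exists_isTeichmullerPow (hp2 : p ≠ 2) (t : ℕ) :
    ∃ χ : MulChar (ZMod p) ℚ_[p], IsTeichmullerPow χ t := by
  have hpP : p.Prime := hp.out
  have he1 : cyclotomicExponent p = 1 := by
    unfold cyclotomicExponent
    rw [if_neg hp2]
  have hpe : p ^ cyclotomicExponent p = p := by rw [he1, pow_one]
  -- transport `ZMod p ≃ ZMod (p ^ e₀)`
  let ψ : ZMod p ≃+* ZMod (p ^ cyclotomicExponent p) := ZMod.ringEquivCongr hpe.symm
  -- the Teichmüller unit hom `(ℤ/p^{e₀})ˣ →* ℤ_pˣ`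
  let ω : (ZMod (p ^ cyclotomicExponent p))ˣ →* ℤ_[p]ˣ :=
    { toFun := fun u => ((teichRep p u : rootsOfUnity (torsionOrder p) ℤ_[p]) : ℤ_[p]ˣ)
      map_one' := by rw [teichRep_one]; rfl
      map_mul' := fun u v => by rw [teichRep_mul]; rfl }
  let ι : ℤ_[p]ˣ →* ℚ_[p]ˣ := Units.map (PadicInt.Coe.ringHom (p := p)).toMonoidHom
  let φ : (ZMod p)ˣ →* ℚ_[p]ˣ :=
    (powMonoidHom t).comp (ι.comp (ω.comp (Units.map ψ.toRingHom.toMonoidHom)))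
  refine ⟨MulChar.ofUnitHom φ, fun a ha => ?_⟩
  -- evaluate `χ a`
  have hau : IsUnit a := isUnit_iff_ne_zero.mpr ha
  set u : (ZMod (p ^ cyclotomicExponent p))ˣ := Units.map ψ.toRingHom.toMonoidHom hau.unit with hu
  set x : ℤ_[p] := (((teichRep p u : rootsOfUnity (torsionOrder p) ℤ_[p]) : ℤ_[p]ˣ) : ℤ_[p])
    with hx
  have hχ : MulChar.ofUnitHom φ a = ((x : ℚ_[p])) ^ t := by
    rw [show a = (hau.unit : ZMod p) from hau.unit_spec.symm, MulChar.ofUnitHom_coe]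
    simp only [φ, ι, ω, MonoidHom.coe_comp, Function.comp_apply, powMonoidHom_apply,
      Units.val_pow_eq_pow_val]
    rfl
  -- `x ≡ a.val (mod p)` in `ℤ_p`
  have hval : ((a.val : ℕ) : ZMod (p ^ cyclotomicExponent p)) =
      (u : ZMod (p ^ cyclotomicExponent p)) := by
    rw [hu, Units.coe_map, RingHom.toMonoidHom_eq_coe, MonoidHom.coe_coe, IsUnit.unit_spec,
      RingEquiv.toRingHom_eq_coe, RingHom.coe_coe]
    have h1 : (ψ a).val = a.val := ZMod.ringEquivCongr_val hpe.symm a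
    rw [← h1, ZMod.natCast_zmod_val]
  have hdvd : (p : ℤ_[p]) ∣ x - (a.val : ℤ_[p]) := by
    have h := pow_dvd_teichRep_sub_natCast p u a.val hval
    rw [he1, pow_one] at h
    exact h
  -- hence `x^t ≡ a.val^t (mod p)` and the norm estimate
  have hdvd' : (p : ℤ_[p]) ∣ x ^ t - (a.val : ℤ_[p]) ^ t :=
    dvd_trans hdvd (sub_dvd_pow_sub_pow x _ t)
  have hnorm : ‖x ^ t - (a.val : ℤ_[p]) ^ t‖ < 1 := (PadicInt.norm_lt_one_iff_dvd _).mpr hdvd'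
  rw [hχ]
  have hcast : ((x : ℚ_[p])) ^ t - ((a.val : ℚ_[p])) ^ t = ((x ^ t - (a.val : ℤ_[p]) ^ t : ℤ_[p]) : ℚ_[p]) := by
    push_cast
    rfl
  rw [hcast, PadicInt.padic_norm_e_of_padicInt]
  exact hnorm

end CensusX43

end Summit.BirchSwinnertonDyer.Rank1Residual.Additive

end
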